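import Mathlib
import Summits.KontsevichZagierPeriods.KontsevichZagierPeriods.Theorems.SoloInformedParityFaces
import Summits.KontsevichZagierPeriods.KontsevichZagierPeriods.Theorems.SoloInformedBlockSolids
import HarnessLib
import HarnessLib.Audit

/-!
# SoloInformed — length faces: `ζ(3)/log³2`, `ζ(3)/(π² log 2)`, `ζ(5)/(π² ζ(3))`, `ζ(3)²/π⁶`

`SoloInformedParityFaces` proved, for two sub-graph solids `E_{q₁}, E_{q₂} ⊂ [0,1]ⁿ⁺¹`
(`E_q = {(x,t) : t · q(x) ≤ 1}`, `q ≥ 1` on the cube), the exact equivalence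
`LocRung_{n+1} → (NoLocRel(q₁,q₂) ↔ vol E_{q₁} / vol E_{q₂} ∉ ℚ)`
(`soloInformed_locRung_subgraphNoLocRelation_iff`), and exhibited faces which a SIGN invariant
separates (`ζ(2k+1)/π^{2k+1}`, `G/π²`).  The sign does NOT separate two solids whose top weight-graded
pieces have the same degree and the same sign.  The present file records four such faces, all built
from the alternating-zeta solids `E_η(n) = E_{1 + x₀⋯x_{n−1}}` (volume `η(n) = (1 − 2^{1−n}) ζ(n)`,
`soloInformed_value_etaSolid`), the **log cube** `Λ_n = E_{∏(1+xᵢ)}` (volume `(log 2)ⁿ`,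
`soloInformed_value_logSolid`) and **block products** `E_{q₁ ⊠ q₂}` of solids in disjoint variables
(volume `vol E_{q₁} · vol E_{q₂}`, `soloInformed_value_blockRep` — Fubini):

* **L1** (`LocRung₄`): `E_η(3)` against `Λ₃` — **`NoLocRel ↔ ζ(3)/(log 2)³ ∉ ℚ`**;
* **L2** (`LocRung₄`): `E_η(3)` against `E_η(2) ⊠ Λ₁ = E_{(1+x₀x₁)(1+x₂)}` (volume `(π²/12) log 2`) —
  **`NoLocRel ↔ ζ(3)/(π² log 2) ∉ ℚ`**;
* **L3** (`LocRung₆`): `E_η(5)` against `E_η(3) ⊠ E_η(2)` (volume `η(3) π²/12`) —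
  **`NoLocRel ↔ ζ(5)/(π² ζ(3)) ∉ ℚ`**;
* **L4** (`LocRung₇`): `E_η(3) ⊠ E_η(3)` (volume `η(3)²`) against `E_η(2) ⊠ E_η(2) ⊠ E_η(2)` (volume
  `π⁶/1728`) — **`NoLocRel ↔ ζ(3)²/π⁶ ∉ ℚ`**, a face STRONGER than the parity face `ζ(3)/π³ ∉ ℚ`
  (`soloInformed_zetaThreeOverPiCubed_of_sq`).

All four irrationality statements are OPEN (nothing is known about the arithmetic nature of
`ζ(3)/π³`, of `ζ(5)`, or of polynomial relations between `ζ(3)`, `π` and `log 2`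
[Waldschmidt 2004, §3; Finch 2003, §1.6]); each is a consequence of the conjectured algebraic
independence of `π, log 2, ζ(3), ζ(5)` (Grothendieck's period conjecture for mixed Tate motives over
`ℤ[1/2]`).  Under the Kontsevich–Zagier conjecture each face is thus an explicit no-certificate
statement between two solids in one cube (`soloInformed_kz_lengthFaces`).

The residency's paper (§3quater, Theorem II‴) proves the four `NoLocRel` statements OUTSIDE the
kernel by a LENGTH invariant: the unipotent radical `U` of the Tannaka group of the realisation
category `𝓗` (Betti–de Rham triples) acts on formal periods; `(u − 1)` kills the pure periods
`⟦π⟧`, `η̃(2)`, acts on `η̃(3), η̃(5)` (motivic `Li_n(−1)`, primitive by Goncharov's coproduct formula)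
and on `log̃ 2` by adding a non-zero rational multiple of `1̃` (non-splitting of odd-weight
extensions, by reality of the period), so that `η̃(3)` has length `1` while `(log̃ 2)³` has length `3`,
etc.  The kernel content here is the exact equivalence at each rung and the volume computations.

Residency `solo-KontsevichZagierPeriods-informed` (PLAN.md, session s20).
References: M. Kontsevich, D. Zagier, *Periods* (2001), §1.2, §4.1; F. Brown, *Notes on motivic
periods*, Commun. Number Theory Phys. 11 (2017), §§2.5, 3.1, 3.8 (arXiv:1512.06410);
A. B. Goncharov, *Galois symmetries of fundamental groupoids and noncommutative geometry*, Duke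
Math. J. 128 (2005), Cor. 6.2 (arXiv:math/0208144); M. Waldschmidt, *Open Diophantine problems*,
Moscow Math. J. 4 (2004), §3; S. R. Finch, *Mathematical constants* (CUP 2003), §1.6.
-/

noncomputable section

open MeasureTheory Set Filter
open scoped Topology

namespace Summit.KontsevichZagierPeriods.KontsevichZagierPeriods.Theorems

open Literature.NumberTheory.Transcendental Literature.NumberTheory.Transcendental.KZ

/-! ### Face L1 (`LocRung₄`): `E_η(3)` against the log cube `Λ₃` — `ζ(3)/(log 2)³` -/

/-- **`ζ(3)/(log 2)³ ∉ ℚ`** — OPEN (no polynomial relation between `ζ(3)` and `log 2` is known or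
excluded; a consequence of the conjectured algebraic independence of `log 2` and `ζ(3)`)
[Waldschmidt 2004, §3]. -/
@[conjecture] def SoloInformedZetaThreeOverLogTwoCubedIrrational : Prop :=
  Irrational (zetaValue 3 / Real.log 2 ^ 3)

/-- **`NoLocRel(η₃, Λ₃)`**: no `N` and no positive `a, b` with `⟦[π]⟧ᴺ · ⟦a·[E_η(3)] − b·[Λ₃]⟧ = 0`,
where `E_η(3) = {t (1 + x₀x₁x₂) ≤ 1}` (volume `(3/4) ζ(3)`) and `Λ₃ = {t (1+x₀)(1+x₁)(1+x₂) ≤ 1}`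
(volume `(log 2)³`) are solids in `[0,1]⁴` (proved in the residency's paper, §3quater, from the
length invariant; OPEN as a kernel statement). -/
@[conjecture] def SoloInformedEtaThreeLogCubeNoLocRelation : Prop :=
  ∀ N a b : ℕ, a ≠ 0 → b ≠ 0 →
    toFormalPeriod (of piRep) ^ N *
      toFormalPeriod (a • of (soloInformedEtaSolid 3) - b • of (soloInformedLogSolid 3)) ≠ 0

/-- `vol E_η(3) / vol Λ₃ ∉ ℚ ↔ ζ(3)/(log 2)³ ∉ ℚ` (the factor `3/4 ∈ ℚˣ`). -/
theorem soloInformed_faceL1_ratio_iff :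
    Irrational ((soloInformedSubgraphRep (soloInformedEtaPoly 3) (soloInformed_etaPoly_ge_one 3)).value /
        (soloInformedSubgraphRep (soloInformedLogPoly 3) (soloInformed_logPoly_ge_one 3)).value) ↔
      SoloInformedZetaThreeOverLogTwoCubedIrrational := by
  rw [soloInformed_value_etaSolid_three,
    show (soloInformedSubgraphRep (soloInformedLogPoly 3) (soloInformed_logPoly_ge_one 3)).value =
      Real.log 2 ^ 3 from soloInformed_value_logSolid 3]
  exact soloInformed_irrational_congr_ratMul (3 / 4 : ℚ) (by norm_num) (mul_div_assoc _ _ _)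

/-- **Face L1: `LocRung₄ → (NoLocRel(η₃, Λ₃) ↔ ζ(3)/(log 2)³ ∉ ℚ)`.** -/
theorem soloInformed_locRung_four_faceL1_iff (h : SoloInformedLocVolumeRung 4) :
    SoloInformedEtaThreeLogCubeNoLocRelation ↔ SoloInformedZetaThreeOverLogTwoCubedIrrational :=
  (soloInformed_locRung_subgraphNoLocRelation_iff (soloInformedEtaPoly 3) (soloInformedLogPoly 3)
    (soloInformed_etaPoly_ge_one 3) (soloInformed_logPoly_ge_one 3) h).trans soloInformed_faceL1_ratio_iff

/-- `Rung₄ → (NoLocRel(η₃, Λ₃) ↔ ζ(3)/(log 2)³ ∉ ℚ)`. -/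
theorem soloInformed_rung_four_faceL1_iff (h : SoloInformedVolumeRung 4) :
    SoloInformedEtaThreeLogCubeNoLocRelation ↔ SoloInformedZetaThreeOverLogTwoCubedIrrational :=
  soloInformed_locRung_four_faceL1_iff (soloInformed_locVolumeRung_of_volumeRung h)

/-- `ζ(3)/(log 2)³ ∉ ℚ → NoLocRel(η₃, Λ₃)`, unconditionally. -/
theorem soloInformed_faceL1_of_irrational (hirr : SoloInformedZetaThreeOverLogTwoCubedIrrational) :
    SoloInformedEtaThreeLogCubeNoLocRelation := fun N a b ha _ =>
  soloInformed_subgraphNoLocRelation_of_irrational _ _ _ _ (soloInformed_faceL1_ratio_iff.2 hirr) N a b ha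

/-! ### Face L2 (`LocRung₄`): `E_η(3)` against `E_η(2) ⊠ Λ₁ = E_{(1+x₀x₁)(1+x₂)}` — `ζ(3)/(π² log 2)` -/

/-- `(1 + x₀x₁)(1 + x₂) ∈ ℚ[x₀, x₁, x₂]`. -/
def soloInformedEtaTwoLogPoly : MvPolynomial (Fin 3) ℚ :=
  soloInformedBlockMul (soloInformedEtaPoly 2) (soloInformedLogPoly 1)

/-- `(1 + x₀x₁)(1 + x₂) ≥ 1` on the cube. -/
theorem soloInformed_etaTwoLogPoly_ge_one :
    ∀ x ∈ KZ.cube 3, (1 : ℝ) ≤ MvPolynomial.aeval x soloInformedEtaTwoLogPoly :=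
  soloInformed_blockMul_ge_one _ _ (soloInformed_etaPoly_ge_one 2) (soloInformed_logPoly_ge_one 1)

/-- **`E_{(1+x₀x₁)(1+x₂)} = {t (1 + x₀x₁)(1 + x₂) ≤ 1} ⊂ [0,1]⁴`**, volume `η(2) log 2 = (π²/12) log 2`. -/
def soloInformedEtaTwoLogSolid : IntegralRep 4 :=
  soloInformedSubgraphRep soloInformedEtaTwoLogPoly soloInformed_etaTwoLogPoly_ge_one

/-- `vol E_{(1+x₀x₁)(1+x₂)} = (ζ(2)/2) · log 2`. -/
theorem soloInformed_value_etaTwoLogSolid :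
    (soloInformedSubgraphRep soloInformedEtaTwoLogPoly soloInformed_etaTwoLogPoly_ge_one).value =
      ((1 / 2 : ℚ) : ℝ) * zetaValue 2 * Real.log 2 :=
  (soloInformed_value_blockRep (soloInformedEtaPoly 2) (soloInformedLogPoly 1)
    (soloInformed_etaPoly_ge_one 2) (soloInformed_logPoly_ge_one 1)).trans (by
      rw [soloInformed_value_etaSolid_two,
        show (soloInformedSubgraphRep (soloInformedLogPoly 1) (soloInformed_logPoly_ge_one 1)).value =
          Real.log 2 ^ 1 from soloInformed_value_logSolid 1, pow_one])

/-- **`ζ(3)/(π² log 2) ∉ ℚ`** — OPEN (a consequence of the conjectured algebraic independence of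
`π, log 2, ζ(3)`) [Waldschmidt 2004, §3]. -/
@[conjecture] def SoloInformedZetaThreeOverPiSqLogTwoIrrational : Prop :=
  Irrational (zetaValue 3 / (Real.pi ^ 2 * Real.log 2))

/-- **`NoLocRel(η₃, η₂ ⊠ Λ₁)`**: no `N` and no positive `a, b` with
`⟦[π]⟧ᴺ · ⟦a·[E_η(3)] − b·[E_{(1+x₀x₁)(1+x₂)}]⟧ = 0` (solids in `[0,1]⁴` of volumes `(3/4) ζ(3)` and
`(π²/12) log 2`; proved in the paper, §3quater; OPEN as a kernel statement). -/
@[conjecture] def SoloInformedEtaThreeEtaTwoLogNoLocRelation : Prop :=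
  ∀ N a b : ℕ, a ≠ 0 → b ≠ 0 →
    toFormalPeriod (of piRep) ^ N *
      toFormalPeriod (a • of (soloInformedEtaSolid 3) - b • of soloInformedEtaTwoLogSolid) ≠ 0

/-- `vol E_η(3) / vol E_{(1+x₀x₁)(1+x₂)} ∉ ℚ ↔ ζ(3)/(π² log 2) ∉ ℚ` (Euler: `ζ(2) ∈ ℚˣ π²`). -/
theorem soloInformed_faceL2_ratio_iff :
    Irrational ((soloInformedSubgraphRep (soloInformedEtaPoly 3) (soloInformed_etaPoly_ge_one 3)).value /
        (soloInformedSubgraphRep soloInformedEtaTwoLogPoly soloInformed_etaTwoLogPoly_ge_one).value) ↔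
      SoloInformedZetaThreeOverPiSqLogTwoIrrational := by
  obtain ⟨q, hq0, hq⟩ := soloInformed_exists_rat_zetaValue_two
  rw [soloInformed_value_etaSolid_three, soloInformed_value_etaTwoLogSolid, hq]
  have hq' : (q : ℝ) ≠ 0 := by exact_mod_cast hq0
  have hπ : Real.pi ≠ 0 := Real.pi_pos.ne'
  have hl : Real.log 2 ≠ 0 := (Real.log_pos one_lt_two).ne'
  refine soloInformed_irrational_congr_ratMul (3 / (2 * q) : ℚ) (by positivity) ?_
  push_cast
  field_simp
  ring

/-- **Face L2: `LocRung₄ → (NoLocRel(η₃, η₂ ⊠ Λ₁) ↔ ζ(3)/(π² log 2) ∉ ℚ)`.** -/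
theorem soloInformed_locRung_four_faceL2_iff (h : SoloInformedLocVolumeRung 4) :
    SoloInformedEtaThreeEtaTwoLogNoLocRelation ↔ SoloInformedZetaThreeOverPiSqLogTwoIrrational :=
  (soloInformed_locRung_subgraphNoLocRelation_iff (soloInformedEtaPoly 3) soloInformedEtaTwoLogPoly
    (soloInformed_etaPoly_ge_one 3) soloInformed_etaTwoLogPoly_ge_one h).trans
    soloInformed_faceL2_ratio_iff

/-- `Rung₄ → (NoLocRel(η₃, η₂ ⊠ Λ₁) ↔ ζ(3)/(π² log 2) ∉ ℚ)`. -/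
theorem soloInformed_rung_four_faceL2_iff (h : SoloInformedVolumeRung 4) :
    SoloInformedEtaThreeEtaTwoLogNoLocRelation ↔ SoloInformedZetaThreeOverPiSqLogTwoIrrational :=
  soloInformed_locRung_four_faceL2_iff (soloInformed_locVolumeRung_of_volumeRung h)

/-- `ζ(3)/(π² log 2) ∉ ℚ → NoLocRel(η₃, η₂ ⊠ Λ₁)`, unconditionally. -/
theorem soloInformed_faceL2_of_irrational (hirr : SoloInformedZetaThreeOverPiSqLogTwoIrrational) :
    SoloInformedEtaThreeEtaTwoLogNoLocRelation := fun N a b ha _ =>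
  soloInformed_subgraphNoLocRelation_of_irrational _ _ _ _ (soloInformed_faceL2_ratio_iff.2 hirr) N a b ha

/-! ### Face L3 (`LocRung₆`): `E_η(5)` against `E_η(3) ⊠ E_η(2)` — `ζ(5)/(π² ζ(3))` -/

/-- `(1 + x₀x₁x₂)(1 + x₃x₄) ∈ ℚ[x₀, …, x₄]`. -/
def soloInformedEtaThreeTwoPoly : MvPolynomial (Fin 5) ℚ :=
  soloInformedBlockMul (soloInformedEtaPoly 3) (soloInformedEtaPoly 2)

/-- `(1 + x₀x₁x₂)(1 + x₃x₄) ≥ 1` on the cube. -/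
theorem soloInformed_etaThreeTwoPoly_ge_one :
    ∀ x ∈ KZ.cube 5, (1 : ℝ) ≤ MvPolynomial.aeval x soloInformedEtaThreeTwoPoly :=
  soloInformed_blockMul_ge_one _ _ (soloInformed_etaPoly_ge_one 3) (soloInformed_etaPoly_ge_one 2)

/-- **`E_{(1+x₀x₁x₂)(1+x₃x₄)} ⊂ [0,1]⁶`**, volume `η(3) η(2) = (3/4) ζ(3) · π²/12`. -/
def soloInformedEtaThreeTwoSolid : IntegralRep 6 :=
  soloInformedSubgraphRep soloInformedEtaThreeTwoPoly soloInformed_etaThreeTwoPoly_ge_one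

/-- `vol E_{(1+x₀x₁x₂)(1+x₃x₄)} = (3/4) ζ(3) · (ζ(2)/2)`. -/
theorem soloInformed_value_etaThreeTwoSolid :
    (soloInformedSubgraphRep soloInformedEtaThreeTwoPoly soloInformed_etaThreeTwoPoly_ge_one).value =
      ((3 / 4 : ℚ) : ℝ) * zetaValue 3 * (((1 / 2 : ℚ) : ℝ) * zetaValue 2) :=
  (soloInformed_value_blockRep (soloInformedEtaPoly 3) (soloInformedEtaPoly 2)
    (soloInformed_etaPoly_ge_one 3) (soloInformed_etaPoly_ge_one 2)).trans (by
      rw [soloInformed_value_etaSolid_three, soloInformed_value_etaSolid_two])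

/-- **`ζ(5)/(π² ζ(3)) ∉ ℚ`** — OPEN (even the irrationality of `ζ(5)` is open; a consequence of the
conjectured algebraic independence of `π, ζ(3), ζ(5)`) [Waldschmidt 2004, §3; Finch 2003, §1.6]. -/
@[conjecture] def SoloInformedZetaFiveOverPiSqZetaThreeIrrational : Prop :=
  Irrational (zetaValue 5 / (Real.pi ^ 2 * zetaValue 3))

/-- **`NoLocRel(η₅, η₃ ⊠ η₂)`**: no `N` and no positive `a, b` with
`⟦[π]⟧ᴺ · ⟦a·[E_η(5)] − b·[E_{(1+x₀x₁x₂)(1+x₃x₄)}]⟧ = 0` (solids in `[0,1]⁶` of volumes `(15/16) ζ(5)`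
and `(3/4) ζ(3) π²/12`; proved in the paper, §3quater; OPEN as a kernel statement). -/
@[conjecture] def SoloInformedEtaFiveEtaThreeTwoNoLocRelation : Prop :=
  ∀ N a b : ℕ, a ≠ 0 → b ≠ 0 →
    toFormalPeriod (of piRep) ^ N *
      toFormalPeriod (a • of (soloInformedEtaSolid 5) - b • of soloInformedEtaThreeTwoSolid) ≠ 0

/-- `vol E_η(5) / vol E_{(1+x₀x₁x₂)(1+x₃x₄)} ∉ ℚ ↔ ζ(5)/(π² ζ(3)) ∉ ℚ`. -/
theorem soloInformed_faceL3_ratio_iff :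
    Irrational ((soloInformedSubgraphRep (soloInformedEtaPoly 5) (soloInformed_etaPoly_ge_one 5)).value /
        (soloInformedSubgraphRep soloInformedEtaThreeTwoPoly soloInformed_etaThreeTwoPoly_ge_one).value) ↔
      SoloInformedZetaFiveOverPiSqZetaThreeIrrational := by
  obtain ⟨q, hq0, hq⟩ := soloInformed_exists_rat_zetaValue_two
  rw [soloInformed_value_etaSolid_five, soloInformed_value_etaThreeTwoSolid, hq]
  have hq' : (q : ℝ) ≠ 0 := by exact_mod_cast hq0
  have hπ : Real.pi ≠ 0 := Real.pi_pos.ne'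
  have hζ : zetaValue 3 ≠ 0 := (soloInformed_zetaValue_pos (n := 3) (by norm_num)).ne'
  refine soloInformed_irrational_congr_ratMul (5 / (2 * q) : ℚ) (by positivity) ?_
  push_cast
  field_simp
  ring

/-- **Face L3: `LocRung₆ → (NoLocRel(η₅, η₃ ⊠ η₂) ↔ ζ(5)/(π² ζ(3)) ∉ ℚ)`.** -/
theorem soloInformed_locRung_six_faceL3_iff (h : SoloInformedLocVolumeRung 6) :
    SoloInformedEtaFiveEtaThreeTwoNoLocRelation ↔ SoloInformedZetaFiveOverPiSqZetaThreeIrrational :=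
  (soloInformed_locRung_subgraphNoLocRelation_iff (soloInformedEtaPoly 5) soloInformedEtaThreeTwoPoly
    (soloInformed_etaPoly_ge_one 5) soloInformed_etaThreeTwoPoly_ge_one h).trans
    soloInformed_faceL3_ratio_iff

/-- `Rung₆ → (NoLocRel(η₅, η₃ ⊠ η₂) ↔ ζ(5)/(π² ζ(3)) ∉ ℚ)`. -/
theorem soloInformed_rung_six_faceL3_iff (h : SoloInformedVolumeRung 6) :
    SoloInformedEtaFiveEtaThreeTwoNoLocRelation ↔ SoloInformedZetaFiveOverPiSqZetaThreeIrrational :=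
  soloInformed_locRung_six_faceL3_iff (soloInformed_locVolumeRung_of_volumeRung h)

/-- `ζ(5)/(π² ζ(3)) ∉ ℚ → NoLocRel(η₅, η₃ ⊠ η₂)`, unconditionally. -/
theorem soloInformed_faceL3_of_irrational (hirr : SoloInformedZetaFiveOverPiSqZetaThreeIrrational) :
    SoloInformedEtaFiveEtaThreeTwoNoLocRelation := fun N a b ha _ =>
  soloInformed_subgraphNoLocRelation_of_irrational _ _ _ _ (soloInformed_faceL3_ratio_iff.2 hirr) N a b ha

/-! ### Face L4 (`LocRung₇`): `E_η(3) ⊠ E_η(3)` against `E_η(2) ⊠ E_η(2) ⊠ E_η(2)` — `ζ(3)²/π⁶` -/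

/-- `(1 + x₀x₁x₂)(1 + x₃x₄x₅) ∈ ℚ[x₀, …, x₅]`. -/
def soloInformedEtaThreeThreePoly : MvPolynomial (Fin 6) ℚ :=
  soloInformedBlockMul (soloInformedEtaPoly 3) (soloInformedEtaPoly 3)

/-- `(1 + x₀x₁x₂)(1 + x₃x₄x₅) ≥ 1` on the cube. -/
theorem soloInformed_etaThreeThreePoly_ge_one :
    ∀ x ∈ KZ.cube 6, (1 : ℝ) ≤ MvPolynomial.aeval x soloInformedEtaThreeThreePoly :=
  soloInformed_blockMul_ge_one _ _ (soloInformed_etaPoly_ge_one 3) (soloInformed_etaPoly_ge_one 3)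

/-- **`E_{(1+x₀x₁x₂)(1+x₃x₄x₅)} ⊂ [0,1]⁷`**, volume `η(3)² = (9/16) ζ(3)²`. -/
def soloInformedEtaThreeThreeSolid : IntegralRep 7 :=
  soloInformedSubgraphRep soloInformedEtaThreeThreePoly soloInformed_etaThreeThreePoly_ge_one

/-- `vol E_{(1+x₀x₁x₂)(1+x₃x₄x₅)} = ((3/4) ζ(3))²`. -/
theorem soloInformed_value_etaThreeThreeSolid :
    (soloInformedSubgraphRep soloInformedEtaThreeThreePoly soloInformed_etaThreeThreePoly_ge_one).value =
      ((3 / 4 : ℚ) : ℝ) * zetaValue 3 * (((3 / 4 : ℚ) : ℝ) * zetaValue 3) :=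
  (soloInformed_value_blockRep (soloInformedEtaPoly 3) (soloInformedEtaPoly 3)
    (soloInformed_etaPoly_ge_one 3) (soloInformed_etaPoly_ge_one 3)).trans (by
      rw [soloInformed_value_etaSolid_three])

/-- `(1 + x₀x₁)(1 + x₂x₃) ∈ ℚ[x₀, …, x₃]`. -/
def soloInformedEtaTwoTwoPoly : MvPolynomial (Fin 4) ℚ :=
  soloInformedBlockMul (soloInformedEtaPoly 2) (soloInformedEtaPoly 2)

/-- `(1 + x₀x₁)(1 + x₂x₃) ≥ 1` on the cube. -/
theorem soloInformed_etaTwoTwoPoly_ge_one :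
    ∀ x ∈ KZ.cube 4, (1 : ℝ) ≤ MvPolynomial.aeval x soloInformedEtaTwoTwoPoly :=
  soloInformed_blockMul_ge_one _ _ (soloInformed_etaPoly_ge_one 2) (soloInformed_etaPoly_ge_one 2)

/-- `vol E_{(1+x₀x₁)(1+x₂x₃)} = (ζ(2)/2)²`. -/
theorem soloInformed_value_etaTwoTwoSolid :
    (soloInformedSubgraphRep soloInformedEtaTwoTwoPoly soloInformed_etaTwoTwoPoly_ge_one).value =
      ((1 / 2 : ℚ) : ℝ) * zetaValue 2 * (((1 / 2 : ℚ) : ℝ) * zetaValue 2) :=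
  (soloInformed_value_blockRep (soloInformedEtaPoly 2) (soloInformedEtaPoly 2)
    (soloInformed_etaPoly_ge_one 2) (soloInformed_etaPoly_ge_one 2)).trans (by
      rw [soloInformed_value_etaSolid_two])

/-- `(1 + x₀x₁)(1 + x₂x₃)(1 + x₄x₅) ∈ ℚ[x₀, …, x₅]`. -/
def soloInformedEtaTwoTwoTwoPoly : MvPolynomial (Fin 6) ℚ :=
  soloInformedBlockMul soloInformedEtaTwoTwoPoly (soloInformedEtaPoly 2)

/-- `(1 + x₀x₁)(1 + x₂x₃)(1 + x₄x₅) ≥ 1` on the cube. -/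
theorem soloInformed_etaTwoTwoTwoPoly_ge_one :
    ∀ x ∈ KZ.cube 6, (1 : ℝ) ≤ MvPolynomial.aeval x soloInformedEtaTwoTwoTwoPoly :=
  soloInformed_blockMul_ge_one _ _ soloInformed_etaTwoTwoPoly_ge_one (soloInformed_etaPoly_ge_one 2)

/-- **`E_{(1+x₀x₁)(1+x₂x₃)(1+x₄x₅)} ⊂ [0,1]⁷`**, volume `η(2)³ = π⁶/1728`. -/
def soloInformedEtaTwoTwoTwoSolid : IntegralRep 7 :=
  soloInformedSubgraphRep soloInformedEtaTwoTwoTwoPoly soloInformed_etaTwoTwoTwoPoly_ge_one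

/-- `vol E_{(1+x₀x₁)(1+x₂x₃)(1+x₄x₅)} = (ζ(2)/2)³` (`= π⁶/1728`). -/
theorem soloInformed_value_etaTwoTwoTwoSolid :
    (soloInformedSubgraphRep soloInformedEtaTwoTwoTwoPoly soloInformed_etaTwoTwoTwoPoly_ge_one).value =
      ((1 / 2 : ℚ) : ℝ) * zetaValue 2 * (((1 / 2 : ℚ) : ℝ) * zetaValue 2) *
        (((1 / 2 : ℚ) : ℝ) * zetaValue 2) :=
  (soloInformed_value_blockRep soloInformedEtaTwoTwoPoly (soloInformedEtaPoly 2)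
    soloInformed_etaTwoTwoPoly_ge_one (soloInformed_etaPoly_ge_one 2)).trans (by
      rw [soloInformed_value_etaTwoTwoSolid, soloInformed_value_etaSolid_two])

/-- **`ζ(3)²/π⁶ ∉ ℚ`** — OPEN; it implies `ζ(3)/π³ ∉ ℚ` (`soloInformed_zetaThreeOverPiCubed_of_sq`),
"even whether `ζ(3)/π³` is irrational" being open [Finch 2003, §1.6.1 p. 41]; a consequence of
the conjectured algebraic independence of `π, ζ(3)` [Waldschmidt 2004, §3]. -/
@[conjecture] def SoloInformedZetaThreeSqOverPiSixthIrrational : Prop :=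
  Irrational (zetaValue 3 ^ 2 / Real.pi ^ 6)

/-- **`NoLocRel(η₃ ⊠ η₃, η₂ ⊠ η₂ ⊠ η₂)`**: no `N` and no positive `a, b` with
`⟦[π]⟧ᴺ · ⟦a·[E_{(1+x₀x₁x₂)(1+x₃x₄x₅)}] − b·[E_{(1+x₀x₁)(1+x₂x₃)(1+x₄x₅)}]⟧ = 0` (solids in `[0,1]⁷`
of volumes `(9/16) ζ(3)²` and `π⁶/1728`; proved in the paper, §3quater; OPEN as a kernel statement). -/
@[conjecture] def SoloInformedEtaThreeSqEtaTwoCubeNoLocRelation : Prop :=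
  ∀ N a b : ℕ, a ≠ 0 → b ≠ 0 →
    toFormalPeriod (of piRep) ^ N *
      toFormalPeriod (a • of soloInformedEtaThreeThreeSolid - b • of soloInformedEtaTwoTwoTwoSolid) ≠ 0

/-- `vol E_{η₃⊠η₃} / vol E_{η₂⊠η₂⊠η₂} ∉ ℚ ↔ ζ(3)²/π⁶ ∉ ℚ`. -/
theorem soloInformed_faceL4_ratio_iff :
    Irrational ((soloInformedSubgraphRep soloInformedEtaThreeThreePoly soloInformed_etaThreeThreePoly_ge_one).value /
        (soloInformedSubgraphRep soloInformedEtaTwoTwoTwoPoly soloInformed_etaTwoTwoTwoPoly_ge_one).value) ↔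
      SoloInformedZetaThreeSqOverPiSixthIrrational := by
  obtain ⟨q, hq0, hq⟩ := soloInformed_exists_rat_zetaValue_two
  rw [soloInformed_value_etaThreeThreeSolid, soloInformed_value_etaTwoTwoTwoSolid, hq]
  have hq' : (q : ℝ) ≠ 0 := by exact_mod_cast hq0
  have hπ : Real.pi ≠ 0 := Real.pi_pos.ne'
  refine soloInformed_irrational_congr_ratMul (9 / (2 * q ^ 3) : ℚ) (by positivity) ?_
  push_cast
  field_simp
  ring

/-- **Face L4: `LocRung₇ → (NoLocRel(η₃ ⊠ η₃, η₂ ⊠ η₂ ⊠ η₂) ↔ ζ(3)²/π⁶ ∉ ℚ)`.** -/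
theorem soloInformed_locRung_seven_faceL4_iff (h : SoloInformedLocVolumeRung 7) :
    SoloInformedEtaThreeSqEtaTwoCubeNoLocRelation ↔ SoloInformedZetaThreeSqOverPiSixthIrrational :=
  (soloInformed_locRung_subgraphNoLocRelation_iff soloInformedEtaThreeThreePoly soloInformedEtaTwoTwoTwoPoly
    soloInformed_etaThreeThreePoly_ge_one soloInformed_etaTwoTwoTwoPoly_ge_one h).trans
    soloInformed_faceL4_ratio_iff

/-- `Rung₇ → (NoLocRel(η₃ ⊠ η₃, η₂ ⊠ η₂ ⊠ η₂) ↔ ζ(3)²/π⁶ ∉ ℚ)`. -/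
theorem soloInformed_rung_seven_faceL4_iff (h : SoloInformedVolumeRung 7) :
    SoloInformedEtaThreeSqEtaTwoCubeNoLocRelation ↔ SoloInformedZetaThreeSqOverPiSixthIrrational :=
  soloInformed_locRung_seven_faceL4_iff (soloInformed_locVolumeRung_of_volumeRung h)

/-- `ζ(3)²/π⁶ ∉ ℚ → NoLocRel(η₃ ⊠ η₃, η₂ ⊠ η₂ ⊠ η₂)`, unconditionally. -/
theorem soloInformed_faceL4_of_irrational (hirr : SoloInformedZetaThreeSqOverPiSixthIrrational) :
    SoloInformedEtaThreeSqEtaTwoCubeNoLocRelation := fun N a b ha _ =>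
  soloInformed_subgraphNoLocRelation_of_irrational _ _ _ _ (soloInformed_faceL4_ratio_iff.2 hirr) N a b ha

/-- `ζ(3)²/π⁶ ∉ ℚ → ζ(3)/π³ ∉ ℚ`: face L4 dominates the parity face of `SoloInformedParityFaces`. -/
theorem soloInformed_zetaThreeOverPiCubed_of_sq (h : SoloInformedZetaThreeSqOverPiSixthIrrational) :
    SoloInformedZetaThreeOverPiCubedIrrational := by
  refine Irrational.of_pow 2 ?_
  have e : (zetaValue 3 / Real.pi ^ 3) ^ 2 = zetaValue 3 ^ 2 / Real.pi ^ 6 := by ring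
  rw [e]
  exact h

/-! ### Under the conjecture -/

/-- **The four length faces of the Kontsevich–Zagier conjecture.**  Under `KontsevichZagierPeriods`
the no-certificate statements L1–L4 are EXACTLY the open irrationality statements
`ζ(3)/(log 2)³ ∉ ℚ`, `ζ(3)/(π² log 2) ∉ ℚ`, `ζ(5)/(π² ζ(3)) ∉ ℚ`, `ζ(3)²/π⁶ ∉ ℚ`. -/
theorem soloInformed_kz_lengthFaces (hKZ : KontsevichZagierPeriods) :
    (SoloInformedEtaThreeLogCubeNoLocRelation ↔ SoloInformedZetaThreeOverLogTwoCubedIrrational) ∧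
    (SoloInformedEtaThreeEtaTwoLogNoLocRelation ↔ SoloInformedZetaThreeOverPiSqLogTwoIrrational) ∧
    (SoloInformedEtaFiveEtaThreeTwoNoLocRelation ↔ SoloInformedZetaFiveOverPiSqZetaThreeIrrational) ∧
    (SoloInformedEtaThreeSqEtaTwoCubeNoLocRelation ↔ SoloInformedZetaThreeSqOverPiSixthIrrational) :=
  ⟨soloInformed_locRung_four_faceL1_iff (soloInformed_locVolumeRung_of_kzp hKZ 4),
    soloInformed_locRung_four_faceL2_iff (soloInformed_locVolumeRung_of_kzp hKZ 4),
    soloInformed_locRung_six_faceL3_iff (soloInformed_locVolumeRung_of_kzp hKZ 6),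
    soloInformed_locRung_seven_faceL4_iff (soloInformed_locVolumeRung_of_kzp hKZ 7)⟩

/-- **The conjecture predicts the four irrationality statements** as soon as the corresponding
no-certificate statements hold (which the paper proves, §3quater): `KZP ∧ NoLocRel(Lᵢ) → face Lᵢ`. -/
theorem soloInformed_kz_lengthFaces_irrational (hKZ : KontsevichZagierPeriods)
    (h₁ : SoloInformedEtaThreeLogCubeNoLocRelation) (h₂ : SoloInformedEtaThreeEtaTwoLogNoLocRelation)
    (h₃ : SoloInformedEtaFiveEtaThreeTwoNoLocRelation) (h₄ : SoloInformedEtaThreeSqEtaTwoCubeNoLocRelation) :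
    SoloInformedZetaThreeOverLogTwoCubedIrrational ∧ SoloInformedZetaThreeOverPiSqLogTwoIrrational ∧
      SoloInformedZetaFiveOverPiSqZetaThreeIrrational ∧ SoloInformedZetaThreeSqOverPiSixthIrrational :=
  have e := soloInformed_kz_lengthFaces hKZ
  ⟨e.1.1 h₁, e.2.1.1 h₂, e.2.2.1.1 h₃, e.2.2.2.1 h₄⟩

end Summit.KontsevichZagierPeriods.KontsevichZagierPeriods.Theorems
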